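import Literature.NumberTheory.ConnesConsani2021.ArchKernelTier2Panels
import Literature.NumberTheory.ConnesConsani2021.SeriesRemainderBounds
import Literature.NumberTheory.ConnesConsani2021.ProlateProjections
import Literature.NumberTheory.ConnesConsani2021.SpectralCertFrame
import HarnessLib

/-!
# (E-a) Tier 2 — the read-back `hM` of the panel data (T2d soundness), modulo the two Taylor-model inputs

RH-FREE certified-numerics bookkeeping (cell rh-crit, seat rh-crit-cc-iso g4; director-rh 2026-08-26T09:43:03Z (α)
lift; cc-lead R119 (1): the (E-a) entry point of record is t7 g3's
`ArchKernelL1Assembly.section6_enclosures_of_tier2 … (hM : ∀ k < m, ∀ w ∈ Icc (k log 2/m) ((k+1) log 2/m),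
|2·et·(τ_c w).re − Σ_{n<8} sonineQTerm (prolateFun n) (prolateEigen n) (e^w)| ≤ M k) …`).
This file proves EXACTLY that hypothesis, for `m = 2048` and `M = ArchCertT2.panelMQ` (the landed table
`ArchKernelTier2Panels.panelM`, p447146), from:
* the kernel equalities in FLAT form `subSups (tsubI (sigmaTM K) (s8 K)) = panelM[K]` (`K < 64`) for a total
  S₈-model family `s8` — hypothesis `hP` (the sixteen landed group files `ArchKernelTier2PanelsCheck*.lean` certify
  the `Option` form `panelSups combinedLit K = some panelM[K]`; NOTE for the re-check: state kernel facts match-free —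
  rewriting under the `match` of `panelSups` makes the kernel unfold the certificate data («deep recursion»));
* (σ-sound) the Taylor-model enclosure of `w ↦ 2e_t·Re τ_c(c_K + w)` by eng-1's `ArchCertSigma.sigmaTM K`
  (`c_K = (2K+1)·log 2/128`, half-width `hQ`) — hypothesis `hσ` (owner: the K3 read-back);
* (T2b-sound) the Taylor-model enclosure of `w ↦ S₈(e^{c_K + w})`, `S₈ = Σ_{n<8} sonineQTerm (prolateFun n) (prolateEigen n)`,
  by the model `SM` that `panelSups` subtracted (`s8TM hQ 6 (centre K) combinedLit = some SM`) — hypothesis `h8`.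
The proof is the generic Taylor-model plumbing: `tmem_sub`, re-centring (`pmem_shiftI`/`evalR_shiftR`, the sub-panel
offsets `(2s−31)·log 2/4096` enclosed by `ArchCertT2.offset s` from `ArchCertSigma.logTwoI`), `abs_le_tabsI` at the
rational half-width `hs = 1693·10⁻⁷ ≥ log 2/4096`, and the window arithmetic `31·log 2/4096 + hs ≤ hQ`
(`Real.log_two_lt_d9`).  No numerics are re-done here.
WHAT THIS IS NOT: a discharge of (E-a) (the two TM inputs and the slope read-back are separate files), nor any claim
about RH; nothing here bears on the truth of RH.
-/

noncomputable section

open Real Set MeasureTheory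
open Literature.Analysis.ValidatedNumerics.NumericsMP Literature.Analysis.ValidatedNumerics.PolyMP
open Literature.NumberTheory.ConnesConsani2021.ArchCert (S piI frobCoeffMI modeQuantities modes ModeData)
open Literature.NumberTheory.ConnesConsani2021.ArchCertSigma (logTwoI sigmaTM hQ twoEtNum twoEtDen mem_logTwoI)

namespace Literature.NumberTheory.ConnesConsani2021.ArchCertT2

open Literature.NumberTheory.LFunctions

/-- The σ-centre `c_K = (2K+1)·log 2/128` as a real number. [cite: ConnesConsani2021, §6.3 p. 24 (in-kernel (E-a) certificate)] -/
def cK (K : ℕ) : ℝ := (2 * (K : ℝ) + 1) * Real.log 2 / 128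

/-- The sub-panel offset `o_s = (2s − 31)·log 2/4096` as a real number. [cite: ConnesConsani2021, §6.3 p. 24 (in-kernel (E-a) certificate)] -/
def oS (s : ℕ) : ℝ := (2 * (s : ℝ) - 31) * Real.log 2 / 4096

/-- `ArchCertT2.centre K ∋ c_K`. [cite: ConnesConsani2021, §6.3 p. 24 (in-kernel (E-a) certificate)] -/
theorem mem_centre (K : ℕ) : MI.mem S (cK K) (centre K) := by
  have h := MI.mem_divNat (MI.mem_mulInt mem_logTwoI (2 * (K : ℤ) + 1)) (n := 128) (by norm_num)
  refine (congrArg (fun x ↦ MI.mem S x (centre K)) ?_).mp h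
  simp only [cK]; push_cast; ring

/-- `ArchCertT2.offset s ∋ o_s`. [cite: ConnesConsani2021, §6.3 p. 24 (in-kernel (E-a) certificate)] -/
theorem mem_offset (s : ℕ) : MI.mem S (oS s) (offset s) := by
  have h := MI.mem_divNat (MI.mem_mulInt mem_logTwoI (2 * (s : ℤ) - 31)) (n := 4096) (by norm_num)
  refine (congrArg (fun x ↦ MI.mem S x (offset s)) ?_).mp h
  simp only [oS]; push_cast; ring

/-- Window arithmetic: for `s < 32`, `|o_s| + hs ≤ hQ` (`31·log 2/4096 + 1693·10⁻⁷ ≤ 5416·10⁻⁶`, `log 2 < 0.6931471808`).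
[cite: ConnesConsani2021, §6.3 p. 24 (in-kernel (E-a) certificate)] -/
theorem abs_oS_add_hs_le {s : ℕ} (hs32 : s < 32) : |oS s| + (hs : ℝ) ≤ (hQ : ℝ) := by
  have hL := Real.log_two_lt_d9
  have hL0 : 0 < Real.log 2 := Real.log_pos one_lt_two
  have hs31 : (s : ℝ) ≤ 31 := by exact_mod_cast Nat.lt_succ_iff.mp hs32
  have hs0 : (0 : ℝ) ≤ s := by positivity
  have h31 : |(2 * (s : ℝ) - 31)| ≤ 31 := by
    rw [abs_le]; constructor <;> linarith
  have h1 : |oS s| ≤ 31 * Real.log 2 / 4096 := by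
    rw [oS, abs_div, abs_mul, abs_of_pos hL0, abs_of_pos (by norm_num : (0:ℝ) < 4096)]
    exact div_le_div_of_nonneg_right (mul_le_mul_of_nonneg_right h31 hL0.le) (by norm_num)
  simp only [hs, hQ]; push_cast
  linarith

/-- A sub-panel of `[0, log 2]` in the coordinates of its coarse panel: for `k < 2048`, `K = k/32`, `s = k%32` and
`w ∈ [k·log 2/2048, (k+1)·log 2/2048]`, the local variable `y := w − c_K − o_s` has `|y| ≤ log 2/4096 ≤ hs`.
[cite: ConnesConsani2021, §6.3 p. 24 (in-kernel (E-a) certificate)] -/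
theorem abs_local_le {k : ℕ} {w : ℝ}
    (hw : w ∈ Icc ((k : ℝ) * Real.log 2 / 2048) (((k + 1 : ℕ) : ℝ) * Real.log 2 / 2048)) :
    |w - cK (k / 32) - oS (k % 32)| ≤ (hs : ℝ) := by
  have hL := Real.log_two_lt_d9
  have hL0 : 0 < Real.log 2 := Real.log_pos one_lt_two
  have hk : (k : ℝ) = 32 * ((k / 32 : ℕ) : ℝ) + ((k % 32 : ℕ) : ℝ) := by exact_mod_cast (Nat.div_add_mod k 32).symm
  obtain ⟨h1, h2⟩ := hw
  have e1 : cK (k / 32) + oS (k % 32) = ((k : ℝ) + 1 / 2) * Real.log 2 / 2048 := by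
    rw [cK, oS, hk]; ring
  have : |w - cK (k / 32) - oS (k % 32)| ≤ Real.log 2 / 4096 := by
    rw [show w - cK (k / 32) - oS (k % 32) = w - (cK (k / 32) + oS (k % 32)) by ring, e1, abs_le]
    push_cast at h2
    constructor <;> nlinarith
  refine this.trans ?_
  simp only [hs]; push_cast; nlinarith

/-- Re-centring a Taylor model: if `P` models `f` on `|u| ≤ h` and `|o| + h' ≤ h` with `o ∈ O`, then `shiftI S P O` models
`y ↦ f (o + y)` on `|y| ≤ h'`. [cite: Joldes2011, Algorithm 2.2.8 (Taylor shift)] -/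
theorem tmem_shift {h h' : ℚ} {f : ℝ → ℝ} {P : IPoly} (hf : TMem S h f P) {o : ℝ} {O : MI} (ho : MI.mem S o O)
    (hwin : |o| + (h' : ℝ) ≤ (h : ℝ)) : TMem S h' (fun y ↦ f (o + y)) (shiftI S P O) := by
  intro y hy
  have hy' : |o + y| ≤ (h : ℝ) := (abs_add_le o y).trans (by linarith)
  obtain ⟨as, has, hev⟩ := hf (o + y) hy'
  exact ⟨shiftR as o, pmem_shiftI ArchCert.S_pos ho has, by rw [evalR_shiftR, ← hev]⟩

/-- `2·e_t` of the σ models, as a rational (`= ArchCertSigma.twoEtNum/twoEtDen`). [cite: ConnesConsani2021, Lemma 5.4 p. 33 (ε′(1₊) ≃ 22.9965)] -/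
def twoEt : ℚ := (twoEtNum : ℚ) / (twoEtDen : ℚ)

/-- The certificate kernel `τ_c`. [cite: ConnesConsani2021, §6.4 display (opkf1) p. 24] -/
def tauC (v : ℝ) : ℂ :=
  SpectralCert.frameKernel (-(Real.log 2 / 2)) (Real.log 2 / 2) SpectralCert.CertAF.N (fun n ↦ (SpectralCert.CertAF.c n : ℝ)) v

/-- `S₈ = Σ_{n<8} τ(n)T_n` (the head of the series (97)). [cite: ConnesConsani2021, Prop. 5.3 eqs. (97)–(98) p. 32] -/
def S8 (ρ : ℝ) : ℝ := ∑ n ∈ Finset.range 8, sonineQTerm (prolateFun n) (prolateEigen n) ρ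

/-- **The read-back, GENERIC in the data** (the literals are never unfolded in this proof): if the kernel's
`panelSups cd K` equals row `K` of a table for every coarse panel, and the two Taylor-model inputs hold, then every
sub-panel sup of `|2e_t·Re τ_c − S₈∘exp|` is bounded by the table entry. [cite: ConnesConsani2021, §6.4 Fact 6.1 + Lemma 6.3 p. 24 (in-kernel (E-a) certificate); §6.3 p. 24] -/
theorem hM_of_subSups (s8 : ℕ → IPoly) (table : List (List ℤ))
    (hP : ∀ K < 64, subSups (tsubI (sigmaTM K) (s8 K)) = table.getD K [])
    (hσ : ∀ K < 64, TMem S hQ (fun u ↦ 2 * ((twoEt / 2 : ℚ) : ℝ) * (tauC (cK K + u)).re) (sigmaTM K))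
    (h8 : ∀ K < 64, TMem S hQ (fun u ↦ S8 (Real.exp (cK K + u))) (s8 K)) :
    ∀ k : ℕ, k < 2048 → ∀ w ∈ Icc ((k : ℝ) * Real.log 2 / 2048) (((k + 1 : ℕ) : ℝ) * Real.log 2 / 2048),
      |2 * ((twoEt / 2 : ℚ) : ℝ) * (tauC w).re - S8 (Real.exp w)|
        ≤ ((((table.getD (k / 32) []).getD (k % 32) 0 : ℚ) / (S : ℚ) : ℚ) : ℝ) := by
  intro k hk w hw
  set K := k / 32 with hKdef
  set s := k % 32 with hsdef
  have hK : K < 64 := by omega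
  have hs32 : s < 32 := Nat.mod_lt _ (by norm_num)
  have hPK := hP K hK
  set SM := s8 K with hSMdef
  -- the model of the difference on the coarse panel
  have hG : TMem S hQ (fun u ↦ 2 * ((twoEt / 2 : ℚ) : ℝ) * (tauC (cK K + u)).re - S8 (Real.exp (cK K + u)))
      (tsubI (sigmaTM K) SM) := tmem_sub (hσ K hK) (h8 K hK)
  -- re-centred to the sub-panel and bounded by `tabsI`
  have hsh := tmem_shift hG (mem_offset s) (abs_oS_add_hs_le hs32)
  have hy := abs_local_le hw
  rw [← hKdef, ← hsdef] at hy
  have hbound := abs_le_tabsI (by norm_num [hs]) hsh hy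
  -- identify the table entry
  have hrow : (subSups (tsubI (sigmaTM K) SM)).getD s 0 = tabsI S hs (shiftI S (tsubI (sigmaTM K) SM) (offset s)) := by
    simp only [subSups, List.getD_eq_getElem?_getD, List.getElem?_map, List.getElem?_range hs32, Option.map_some,
      Option.getD_some]
  have h1 : (table.getD K []).getD s 0 = tabsI S hs (shiftI S (tsubI (sigmaTM K) SM) (offset s)) := by
    rw [← hPK, hrow]
  have hSpos : (0 : ℝ) < (S : ℝ) := by exact_mod_cast ArchCert.S_pos
  rw [h1]
  push_cast
  rw [le_div_iff₀ hSpos]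
  have e : oS s + (w - cK K - oS s) = w - cK K := by ring
  have e2 : cK K + (w - cK K) = w := by ring
  rw [e] at hbound; rw [e2] at hbound
  push_cast at hbound ⊢
  exact hbound

/-- **The read-back `hM` for the table OF RECORD `panelM`** (`m = 2048`, `M = panelMQ`), for ANY total S₈-model family
`s8` (the stub `fun K ↦ (s8TM hQ 6 (centre K) combinedLit).getD []` today, eng-1's `ArchKernelS8TM` models re-centred by
`shiftI` tomorrow), modulo the kernel equalities `hP` (flat form) and the two Taylor-model inputs.
[cite: ConnesConsani2021, §6.4 Fact 6.1 + Lemma 6.3 p. 24 (in-kernel (E-a) certificate); §6.3 p. 24] -/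
theorem tier2_hM_of (s8 : ℕ → IPoly)
    (hP : ∀ K < 64, subSups (tsubI (sigmaTM K) (s8 K)) = panelM.getD K [])
    (hσ : ∀ K < 64, TMem S hQ (fun u ↦ 2 * ((twoEt / 2 : ℚ) : ℝ) * (tauC (cK K + u)).re) (sigmaTM K))
    (h8 : ∀ K < 64, TMem S hQ (fun u ↦ S8 (Real.exp (cK K + u))) (s8 K)) :
    ∀ k : ℕ, k < 2048 → ∀ w ∈ Icc ((k : ℝ) * Real.log 2 / 2048) (((k + 1 : ℕ) : ℝ) * Real.log 2 / 2048),
      |2 * ((twoEt / 2 : ℚ) : ℝ) * (tauC w).re - S8 (Real.exp w)| ≤ (panelMQ k : ℝ) :=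
  hM_of_subSups s8 panelM hP hσ h8

end Literature.NumberTheory.ConnesConsani2021.ArchCertT2

end
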